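import Mathlib
import HarnessLib
import Summits.NavierStokesRegularity.NavierStokesRegularity.Theorems.TaylorModelRungThreeCertificateFormatVGrowth2
import Summits.NavierStokesRegularity.NavierStokesRegularity.Theorems.TaylorModelRungThreeCertificateFormatVGrowthSound

/-!
# Crux K1b-DR (stmt-NavierStokesRegularity-23954), line `taylor-model` — TWO-LEVEL growth checker (variant B), SOUNDNESS part 1:
# the run keeps the invariant `Inv2` and certifies the TRUE objects (tm-g4 g4)

For `…CertificateFormatVGrowth2` (`GState2`, `GCtx.step2/bdry2/claims2`, `growthRun2/growthRange2`, `vSub/vIn/vOut`, `gD2`,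
`PchM`, `Inv2`): `Array.getD` of `++`; grid arithmetic (`grid_succ_of_not_dvd`, `grid_succ_of_dvd`, `chunk_grid`); the step
Boolean unpacked; **`inv2_step`**, **`inv2_bdry`** (the invariant through a sub-step, inside a sub-block and at a grid point —
`pre_invariant` of the one-level file with base `s/ℓ·ℓ`); **`growthRun2_sound`**, **`growthRange2_sound`** — every sub-step's chain
Boolean, predicate, `0 ≤ L1 ≤ gL1`, and pair tests with the factors of `prodM`/`vIn`/`vOut`, plus a final state satisfying
`Inv2` and `claims2`. MODEL-lattice bookkeeping only (rung TL-M3); nothing here is a statement about the Navier–Stokes equations.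
-/

-- the sub-problem namespace repeats the summit name by design (D-0017)
set_option linter.dupNamespace false

namespace Summit.NavierStokesRegularity.NavierStokesRegularity.Theorems.TaylorModelCert

open scoped BigOperators

open Literature.Analysis.FluidPDE.TaoCascade Literature.Analysis.FluidPDE.TaoCascade.TaylorChain
open Summit.NavierStokesRegularity.NavierStokesRegularity.Theorems.TaylorModelReadout
open Summit.NavierStokesRegularity.NavierStokesRegularity.Theorems.TaylorModelV

/-! ### Helpers: `Array.getD` of `++`, grid arithmetic -/

/-- [folklore] -/
theorem getD_append_lt {α : Type} (a b : Array α) (d : α) {i : ℕ} (h : i < a.size) : (a ++ b).getD i d = a.getD i d := by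
  have h' : i < a.size + b.size := by omega
  simp [Array.getD, h, h', Array.getElem_append_left h]

/-- [folklore] -/
theorem getD_append_ge {α : Type} (a b : Array α) (d : α) {i : ℕ} (h : a.size ≤ i) (hi : i - a.size < b.size) :
    (a ++ b).getD i d = b.getD (i - a.size) d := by
  have h' : i < a.size + b.size := by omega
  simp [Array.getD, h', hi, Array.getElem_append_right h]

/-- The grid start does not move inside a sub-block. [folklore] -/
theorem grid_succ_of_not_dvd {s ℓ : ℕ} (hℓ : 0 < ℓ) (h : (s + 1) % ℓ ≠ 0) : (s + 1) / ℓ * ℓ = s / ℓ * ℓ := by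
  have h1 := Nat.div_add_mod (s + 1) ℓ
  have h2 := Nat.div_add_mod s ℓ
  have hmod : (s + 1) % ℓ = (s % ℓ + 1) % ℓ := by simp [Nat.add_mod]
  by_cases hw : s % ℓ + 1 = ℓ
  · rw [hmod, hw, Nat.mod_self] at h; exact absurd rfl h
  · have hlt : s % ℓ + 1 < ℓ := by have := Nat.mod_lt s hℓ; omega
    rw [Nat.mod_eq_of_lt hlt] at hmod
    have e1 : ℓ * ((s + 1) / ℓ) = ℓ * (s / ℓ) := by omega
    rw [Nat.eq_of_mul_eq_mul_left hℓ e1]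

/-- At a grid point the grid start jumps by `ℓ`. [folklore] -/
theorem grid_succ_of_dvd {s ℓ : ℕ} (hℓ : 0 < ℓ) (h : (s + 1) % ℓ = 0) : s / ℓ * ℓ + ℓ = s + 1 := by
  have h2 := Nat.div_add_mod s ℓ
  have h3 : s % ℓ < ℓ := Nat.mod_lt _ hℓ
  have hmod : (s + 1) % ℓ = (s % ℓ + 1) % ℓ := by simp [Nat.add_mod]
  by_cases hw : s % ℓ + 1 = ℓ
  · rw [Nat.mul_comm]; omega
  · have hlt : s % ℓ + 1 < ℓ := by omega
    rw [hmod, Nat.mod_eq_of_lt hlt] at h; omega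

/-- [folklore] -/
theorem grid_self_of_dvd {s ℓ : ℕ} (h : (s + 1) % ℓ = 0) : (s + 1) / ℓ * ℓ = s + 1 :=
  Nat.div_mul_cancel (Nat.dvd_of_mod_eq_zero h)

namespace CertTablesV

variable {TV : CertTablesV} {kitOf : ℕ → CoreKit} {wT : ℕ → Array Dyad} {sc : ScalarsV}

/-! ### The step and the boundary update preserve the invariant -/

/-- The Boolean of `step2`, unpacked. [folklore] -/
theorem step2_snd_iff (G : GCtx) (ℓ s : ℕ) (M : Array (Array IntervalD)) (coL1 : Dyad) (st : GState2) :
    (G.step2 ℓ s M coL1 st).2 = true ↔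
      (Dyad.ble Dyad.zero coL1 = true ∧ Dyad.ble coL1 (dget G.gL1 s) = true) ∧
      (∀ i < ((st.pre.map fun P => mulII G.n G.prec M P).push M).size,
        G.pairTest (s / ℓ * ℓ + i) (s + 1) (G.facOf (((st.pre.map fun P => mulII G.n G.prec M P).push M).getD i #[]) G.ωhi) = true) ∧
      G.pairTest (s + 1) (s + 1) (G.facOf (idIM G.n) G.ωhi) = true ∧
      (∀ i < s / ℓ * ℓ - G.q * G.L, G.pairTest (G.q * G.L + i) (s + 1)
        (G.facOf (((st.pre.map fun P => mulII G.n G.prec M P).push M).getD 0 #[]) (st.Uin.getD i #[])) = true) ∧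
      (∀ a' < G.q * G.L, G.pairTest a' (s + 1)
        (G.facOf (((st.pre.map fun P => mulII G.n G.prec M P).push M).getD 0 #[]) (st.Uout.getD a' #[])) = true) := by
  simp only [GCtx.step2, Bool.and_eq_true, allN_eq_true, and_assoc]

/-- [folklore] -/ theorem step2_fst_pre (G : GCtx) (ℓ s : ℕ) (M : Array (Array IntervalD)) (coL1 : Dyad) (st : GState2) :
    (G.step2 ℓ s M coL1 st).1.pre = (st.pre.map fun P => mulII G.n G.prec M P).push M := rfl
/-- [folklore] -/ theorem step2_fst_Uin (G : GCtx) (ℓ s : ℕ) (M : Array (Array IntervalD)) (coL1 : Dyad) (st : GState2) :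
    (G.step2 ℓ s M coL1 st).1.Uin = st.Uin := rfl
/-- [folklore] -/ theorem step2_fst_Uout (G : GCtx) (ℓ s : ℕ) (M : Array (Array IntervalD)) (coL1 : Dyad) (st : GState2) :
    (G.step2 ℓ s M coL1 st).1.Uout = st.Uout := rfl
/-- [folklore] -/ theorem step2_fst_Pch (G : GCtx) (ℓ s : ℕ) (M : Array (Array IntervalD)) (coL1 : Dyad) (st : GState2) :
    (G.step2 ℓ s M coL1 st).1.Pch = st.Pch := rfl

/-- One more sub-block of transport. [folklore] -/
theorem vSub_succ (j ℓ g : ℕ) (w : Array Dyad) (m : ℕ) :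
    TV.vSub kitOf wT j ℓ g w (m + 1) =
      absMulVecUp TV.base.n TV.prec (magM TV.base.n (TV.prodM kitOf wT j (g + m * ℓ) ℓ)) (TV.vSub kitOf wT j ℓ g w m) := rfl

section Inv

variable {j L ℓ q : ℕ} (hℓ : 0 < ℓ) (hdvd : ℓ ∣ L)
include hℓ hdvd

omit hℓ in
/-- `qL` is a grid point. [folklore] -/
theorem chunk_grid : q * L / ℓ * ℓ = q * L := Nat.div_mul_cancel (Dvd.dvd.mul_left hdvd q)

omit hℓ in
/-- The grid start lies in the chunk: `qL ≤ s/ℓ·ℓ` for `qL ≤ s`. [folklore] -/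
theorem chunk_le_grid {s : ℕ} (hs : q * L ≤ s) : q * L ≤ s / ℓ * ℓ := by
  rw [← chunk_grid (q := q) hdvd]
  exact Nat.mul_le_mul_right ℓ (Nat.div_le_div_right hs)

omit hdvd in
/-- **Invariant through a step inside a sub-block** (`(s+1) % ℓ ≠ 0`). [folklore] -/
theorem inv2_step {s : ℕ} {st : GState2} (hI : TV.Inv2 kitOf wT j L ℓ q s st) (hnd : (s + 1) % ℓ ≠ 0)
    (coL1 : Dyad) :
    TV.Inv2 kitOf wT j L ℓ q (s + 1) ((TV.gctx j L q).step2 ℓ s (TV.Mk kitOf wT j s) coL1 st).1 := by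
  obtain ⟨h1, h2, h3, h4, h5, h6, h7⟩ := hI
  have hg : (s + 1) / ℓ * ℓ = s / ℓ * ℓ := grid_succ_of_not_dvd hℓ hnd
  have hgs : s / ℓ * ℓ ≤ s := Nat.div_mul_le_self s ℓ
  obtain ⟨hsz', hpre'⟩ := pre_invariant (TV := TV) (kitOf := kitOf) (wT := wT) j (s / ℓ) ℓ s hgs st.pre h1 h2
  refine ⟨?_, ?_, ?_, ?_, ?_, ?_, ?_⟩
  · rw [step2_fst_pre, hg]; exact hsz'
  · intro i hi; rw [step2_fst_pre] at hi ⊢; rw [hg]; exact hpre' i hi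
  · rw [step2_fst_Uin, hg]; exact h3
  · intro i hi; rw [step2_fst_Uin] at hi ⊢; rw [hg]; exact h4 i hi
  · rw [step2_fst_Uout]; exact h5
  · intro a' ha'; rw [step2_fst_Uout, hg]; exact h6 a' ha'
  · intro hlt; rw [step2_fst_Pch]; rw [hg] at hlt ⊢; exact h7 hlt

/-- **Invariant through a step ending at a grid point** (`(s+1) % ℓ = 0`): step, then the boundary update. [folklore] -/
theorem inv2_bdry {s : ℕ} (hs : q * L ≤ s) {st : GState2} (hI : TV.Inv2 kitOf wT j L ℓ q s st) (hd : (s + 1) % ℓ = 0)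
    (coL1 : Dyad) :
    TV.Inv2 kitOf wT j L ℓ q (s + 1)
      ((TV.gctx j L q).bdry2 ℓ s ((TV.gctx j L q).step2 ℓ s (TV.Mk kitOf wT j s) coL1 st).1) := by
  obtain ⟨h1, h2, h3, h4, h5, h6, h7⟩ := hI
  have hgs : s / ℓ * ℓ ≤ s := Nat.div_mul_le_self s ℓ
  have hg1 : s / ℓ * ℓ + ℓ = s + 1 := grid_succ_of_dvd hℓ hd
  have hg' : (s + 1) / ℓ * ℓ = s + 1 := grid_self_of_dvd hd
  have hCg : q * L ≤ s / ℓ * ℓ := chunk_le_grid hdvd hs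
  obtain ⟨hsz', hpre'⟩ := pre_invariant (TV := TV) (kitOf := kitOf) (wT := wT) j (s / ℓ) ℓ s hgs st.pre h1 h2
  set g := s / ℓ * ℓ with hgdef
  set pre' := (st.pre.map fun P => mulII TV.base.n TV.prec (TV.Mk kitOf wT j s) P).push (TV.Mk kitOf wT j s) with hpre'def
  have hszℓ : pre'.size = ℓ := by rw [hsz']; omega
  have hp0 : pre'.getD 0 #[] = TV.prodM kitOf wT j g ℓ := by
    have := hpre' 0 (by rw [hszℓ]; exact hℓ)
    simp only [Nat.add_zero] at this
    rw [this]; congr 1; omega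
  -- unfold the boundary update on the stepped state
  unfold GCtx.bdry2
  simp only [step2_fst_pre, step2_fst_Uin, step2_fst_Uout, step2_fst_Pch, gctx_n, gctx_prec, gctx_q, gctx_L, gctx_ωhi]
  rw [← hpre'def]
  refine ⟨?_, ?_, ?_, ?_, ?_, ?_, ?_⟩
  · simp [hg']
  · intro i hi; simp at hi
  · simp only [Array.size_append, Array.size_map, Array.size_ofFn, h3, hszℓ, hg']; omega
  · intro i hi
    simp only [Array.size_append, Array.size_map, Array.size_ofFn, h3, hszℓ] at hi
    rw [hg']
    by_cases hlt : i < st.Uin.size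
    · -- an earlier start of the chunk: one more sub-block of transport
      have hmap : i < (st.Uin.map fun u => absMulVecUp TV.base.n TV.prec (magM TV.base.n (pre'.getD 0 #[])) u).size := by
        simpa using hlt
      rw [getD_append_lt _ _ _ hmap, getD_map_of_lt _ _ hlt _ #[], h4 i hlt, hp0]
      have ha : q * L + i < g := by rw [h3] at hlt; omega
      set a := q * L + i with hadef
      have hga : (a / ℓ + 1) * ℓ ≤ g := by
        have : a / ℓ < s / ℓ := (Nat.div_lt_iff_lt_mul hℓ).2 (by omega)
        have := Nat.mul_le_mul_right ℓ this; rw [hgdef]; nlinarith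
      obtain ⟨m, hm⟩ : ∃ m, g - (a / ℓ + 1) * ℓ = m * ℓ := by
        refine ⟨s / ℓ - (a / ℓ + 1), ?_⟩; rw [hgdef, Nat.sub_mul]
      have hm' : (g - (a / ℓ + 1) * ℓ) / ℓ = m := by rw [hm]; exact Nat.mul_div_cancel m hℓ
      have em : (m + 1) * ℓ = m * ℓ + ℓ := by ring
      have hm'' : (s + 1 - (a / ℓ + 1) * ℓ) / ℓ = m + 1 := by
        rw [← hg1, show g + ℓ - (a / ℓ + 1) * ℓ = (m + 1) * ℓ by rw [em]; omega]
        exact Nat.mul_div_cancel (m + 1) hℓ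
      rw [hm', hm'']
      show _ = TV.vSub kitOf wT j ℓ ((a / ℓ + 1) * ℓ) _ (m + 1)
      have eg : (a / ℓ + 1) * ℓ + m * ℓ = g := by omega
      unfold vIn
      rw [vSub_succ, eg]
    · -- a start of the finished sub-block: its initial vector
      push Not at hlt
      have hi' : i - st.Uin.size < ℓ := by omega
      have hmapsz : (st.Uin.map fun u => absMulVecUp TV.base.n TV.prec (magM TV.base.n (pre'.getD 0 #[])) u).size = st.Uin.size := by
        simp
      rw [getD_append_ge _ _ _ (by rw [hmapsz]; exact hlt) (by rw [hmapsz, Array.size_ofFn, hszℓ]; exact hi'), hmapsz,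
        getD_ofFn_lt _ (by rw [hszℓ]; exact hi')]
      have hii : i - st.Uin.size < pre'.size := by rw [hszℓ]; exact hi'
      unfold GCtx.rowUp
      simp only [gctx_n, gctx_prec]
      rw [hpre' _ hii]
      set a := q * L + i with hadef
      have ea : g + (i - st.Uin.size) = a := by rw [h3] ; omega
      rw [ea]
      have hadiv : a / ℓ = s / ℓ := div_eq_of_chunk hℓ (by omega) (by omega)
      have e1 : (s + 1 - (a / ℓ + 1) * ℓ) / ℓ = 0 := by
        rw [hadiv, add_mul, one_mul, hg1, Nat.sub_self, Nat.zero_div]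
      rw [e1]
      show _ = TV.vSub kitOf wT j ℓ ((a / ℓ + 1) * ℓ) _ 0
      show _ = absMulVecUp TV.base.n TV.prec (magM TV.base.n (TV.prodM kitOf wT j a ((a / ℓ + 1) * ℓ - a))) (TV.ωhiV j)
      rw [hadiv, add_mul, one_mul, hg1]
  · simp [h5]
  · intro a' ha'
    have hlt : a' < st.Uout.size := by rw [h5]; exact ha'
    rw [getD_map_of_lt _ _ hlt _ #[], h6 a' ha', hp0, hg']
    obtain ⟨m, hm⟩ : ∃ m, g - q * L = m * ℓ := by
      refine ⟨s / ℓ - q * L / ℓ, ?_⟩; rw [hgdef, Nat.sub_mul, chunk_grid hdvd]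
    have hm' : (g - q * L) / ℓ = m := by rw [hm]; exact Nat.mul_div_cancel m hℓ
    have em : (m + 1) * ℓ = m * ℓ + ℓ := by ring
    have hm'' : (s + 1 - q * L) / ℓ = m + 1 := by
      rw [← hg1, show g + ℓ - q * L = (m + 1) * ℓ by rw [em]; omega]
      exact Nat.mul_div_cancel (m + 1) hℓ
    rw [hm', hm'']
    show _ = TV.vSub kitOf wT j ℓ (q * L) _ (m + 1)
    have eg : q * L + m * ℓ = g := by omega
    unfold vOut
    rw [vSub_succ, eg]
  · intro hlt
    rw [hg'] at hlt ⊢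
    obtain ⟨m, hm⟩ : ∃ m, g - q * L = m * ℓ := by
      refine ⟨s / ℓ - q * L / ℓ, ?_⟩; rw [hgdef, Nat.sub_mul, chunk_grid hdvd]
    have em : (m + 1) * ℓ = m * ℓ + ℓ := by ring
    have hm'' : (s + 1 - q * L) / ℓ = m + 1 := by
      rw [← hg1, show g + ℓ - q * L = (m + 1) * ℓ by rw [em]; omega]
      exact Nat.mul_div_cancel (m + 1) hℓ
    rw [hm'']
    by_cases hgC : g = q * L
    · rw [if_pos hgC, hp0, hgC]
      have hm0 : m = 0 := by
        have : m * ℓ = 0 := by rw [← hm, hgC, Nat.sub_self]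
        rcases Nat.mul_eq_zero.1 this with h | h
        · exact h
        · omega
      rw [hm0]
      rfl
    · rw [if_neg hgC, hp0]
      have hClt : q * L < g := lt_of_le_of_ne hCg (Ne.symm hgC)
      have hm' : (g - q * L) / ℓ = m := by rw [hm]; exact Nat.mul_div_cancel m hℓ
      rw [h7 hClt, hm']
      obtain ⟨m₀, hm₀⟩ : ∃ m₀, m = m₀ + 1 := by
        rcases m with _ | m₀
        · exfalso; simp at hm; omega
        · exact ⟨m₀, rfl⟩
      rw [hm₀]
      show _ = mulII TV.base.n TV.prec (TV.prodM kitOf wT j (q * L + (m₀ + 1) * ℓ) ℓ) (TV.PchM kitOf wT j ℓ (q * L) (m₀ + 1))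
      rw [hm₀] at hm
      have eg : q * L + (m₀ + 1) * ℓ = g := by omega
      rw [eg]

/-- **`growthRun2` from the true node state, under the invariant**: every sub-step's chain Boolean, predicate, `0 ≤ L1 ≤ gL1`,
and pair tests with the factors of the TRUE objects (`prodM`, `vIn`, `vOut`); at the end a state satisfying the invariant and the
claims. [folklore] -/
theorem growthRun2_sound (P : ℕ → CoreOut → Bool) :
    ∀ (k s : ℕ) (st : GState2),
      TV.growthRun2 kitOf wT P j ℓ (TV.gctx j L q) k s ((TV.ctxOfW kitOf wT j).nodeAt s) st = true →
      q * L ≤ s → TV.Inv2 kitOf wT j L ℓ q s st →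
      (∀ i, i < k →
        ((TV.ctxOfW kitOf wT j).subStep (s + i) ((TV.ctxOfW kitOf wT j).nodeAt (s + i))).ok = true ∧
        P (s + i) ((TV.ctxOfW kitOf wT j).subStep (s + i) ((TV.ctxOfW kitOf wT j).nodeAt (s + i))).core = true ∧
        (Dyad.ble Dyad.zero (TV.coreVW kitOf wT j (s + i)).L1 = true ∧
          Dyad.ble (TV.coreVW kitOf wT j (s + i)).L1 (dget (TV.gL1 j) (s + i)) = true) ∧
        (∀ i', i' < s + i + 1 - (s + i) / ℓ * ℓ → (TV.gctx j L q).pairTest ((s + i) / ℓ * ℓ + i') (s + i + 1)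
          ((TV.gctx j L q).facOf (TV.prodM kitOf wT j ((s + i) / ℓ * ℓ + i') (s + i + 1 - ((s + i) / ℓ * ℓ + i'))) (TV.ωhiV j)) = true) ∧
        (TV.gctx j L q).pairTest (s + i + 1) (s + i + 1) ((TV.gctx j L q).facOf (idIM TV.base.n) (TV.ωhiV j)) = true ∧
        (∀ i', i' < (s + i) / ℓ * ℓ - q * L → (TV.gctx j L q).pairTest (q * L + i') (s + i + 1)
          ((TV.gctx j L q).facOf (TV.prodM kitOf wT j ((s + i) / ℓ * ℓ) (s + i + 1 - (s + i) / ℓ * ℓ))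
            (TV.vIn kitOf wT j ℓ (q * L + i') (((s + i) / ℓ * ℓ - ((q * L + i') / ℓ + 1) * ℓ) / ℓ))) = true) ∧
        (∀ a' < q * L, (TV.gctx j L q).pairTest a' (s + i + 1)
          ((TV.gctx j L q).facOf (TV.prodM kitOf wT j ((s + i) / ℓ * ℓ) (s + i + 1 - (s + i) / ℓ * ℓ))
            (TV.vOut kitOf wT j L ℓ a' q (((s + i) / ℓ * ℓ - q * L) / ℓ))) = true)) ∧
      ∃ stF : GState2, TV.Inv2 kitOf wT j L ℓ q (s + k) stF ∧ (TV.gctx j L q).claims2 (s + k) stF = true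
  | 0, s, st, h, _, hI => by
    refine ⟨fun i hi => absurd hi (Nat.not_lt_zero i), st, by simpa using hI, ?_⟩
    simpa [growthRun2] using h
  | k + 1, s, st, h, hs, hI => by
    simp only [growthRun2, Bool.and_eq_true] at h
    obtain ⟨⟨⟨hok, hP⟩, hstep⟩, hrest⟩ := h
    have hnext : ((TV.ctxOfW kitOf wT j).subStep s ((TV.ctxOfW kitOf wT j).nodeAt s)).next =
        (TV.ctxOfW kitOf wT j).nodeAt (s + 1) := rfl
    have hM : ((TV.ctxOfW kitOf wT j).subStep s ((TV.ctxOfW kitOf wT j).nodeAt s)).core.M = TV.Mk kitOf wT j s := rfl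
    have hL : ((TV.ctxOfW kitOf wT j).subStep s ((TV.ctxOfW kitOf wT j).nodeAt s)).core.L1 = (TV.coreVW kitOf wT j s).L1 := rfl
    rw [hnext, hM, hL] at hrest
    rw [step2_snd_iff, hM, hL] at hstep
    simp only [gctx_n, gctx_prec, gctx_q, gctx_L, gctx_gL1, gctx_ωhi] at hstep
    obtain ⟨hL1, hIn, hDiag, hMid, hOut⟩ := hstep
    -- the invariant at `s + 1`
    have hI' : TV.Inv2 kitOf wT j L ℓ q (s + 1)
        (if (s + 1) % ℓ = 0 then (TV.gctx j L q).bdry2 ℓ s ((TV.gctx j L q).step2 ℓ s (TV.Mk kitOf wT j s) (TV.coreVW kitOf wT j s).L1 st).1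
          else ((TV.gctx j L q).step2 ℓ s (TV.Mk kitOf wT j s) (TV.coreVW kitOf wT j s).L1 st).1) := by
      by_cases hd : (s + 1) % ℓ = 0
      · rw [if_pos hd]; exact inv2_bdry hℓ hdvd hs hI hd _
      · rw [if_neg hd]; exact inv2_step hℓ hI hd _
    have ih := growthRun2_sound P k (s + 1) _ hrest (by omega) hI'
    -- the objects at step `s` from the invariant
    obtain ⟨h1, h2, h3, h4, h5, h6, -⟩ := hI
    obtain ⟨hsz', hpre'⟩ := pre_invariant (TV := TV) (kitOf := kitOf) (wT := wT) j (s / ℓ) ℓ s (Nat.div_mul_le_self s ℓ) st.pre h1 h2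
    refine ⟨fun i hi => ?_, ?_⟩
    · cases i with
      | zero =>
        simp only [Nat.add_zero]
        refine ⟨hok, hP, hL1, fun i' hi' => ?_, hDiag, fun i' hi' => ?_, fun a' ha' => ?_⟩
        · have hi'' : i' < ((st.pre.map fun P => mulII TV.base.n TV.prec (TV.Mk kitOf wT j s) P).push (TV.Mk kitOf wT j s)).size := by
            rw [hsz']; exact hi'
          have := hIn i' hi''
          rw [hpre' i' hi''] at this
          exact this
        · have h0 : 0 < ((st.pre.map fun P => mulII TV.base.n TV.prec (TV.Mk kitOf wT j s) P).push (TV.Mk kitOf wT j s)).size := by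
            rw [hsz']; have := Nat.div_mul_le_self s ℓ; omega
          have := hMid i' hi'
          rw [hpre' 0 h0, h4 i' (by rw [h3]; exact hi')] at this
          simpa using this
        · have h0 : 0 < ((st.pre.map fun P => mulII TV.base.n TV.prec (TV.Mk kitOf wT j s) P).push (TV.Mk kitOf wT j s)).size := by
            rw [hsz']; have := Nat.div_mul_le_self s ℓ; omega
          have := hOut a' ha'
          rw [hpre' 0 h0, h6 a' ha'] at this
          simpa using this
      | succ i =>
        have := ih.1 i (Nat.lt_of_succ_lt_succ hi)
        simpa only [Nat.add_succ, Nat.succ_add, Nat.add_assoc] using this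
    · obtain ⟨stF, h1, h2⟩ := ih.2
      refine ⟨stF, ?_, ?_⟩
      · have e : s + 1 + k = s + (k + 1) := by omega
        rw [e] at h1; exact h1
      · have e : s + 1 + k = s + (k + 1) := by omega
        rw [e] at h2; exact h2

/-- **Soundness of the two-level chunk check** (start state = checkpoint, initial invariant). [folklore] -/
theorem growthRange2_sound {P : ℕ → CoreOut → Bool} (h : TV.growthRange2 kitOf wT P j L ℓ q = true) :
    (∀ i, i < min L (TV.S j - q * L) →
        ((TV.ctxOfW kitOf wT j).subStep (q * L + i) ((TV.ctxOfW kitOf wT j).nodeAt (q * L + i))).ok = true ∧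
        P (q * L + i) ((TV.ctxOfW kitOf wT j).subStep (q * L + i) ((TV.ctxOfW kitOf wT j).nodeAt (q * L + i))).core = true ∧
        (Dyad.ble Dyad.zero (TV.coreVW kitOf wT j (q * L + i)).L1 = true ∧
          Dyad.ble (TV.coreVW kitOf wT j (q * L + i)).L1 (dget (TV.gL1 j) (q * L + i)) = true) ∧
        (∀ i', i' < q * L + i + 1 - (q * L + i) / ℓ * ℓ → (TV.gctx j L q).pairTest ((q * L + i) / ℓ * ℓ + i') (q * L + i + 1)
          ((TV.gctx j L q).facOf (TV.prodM kitOf wT j ((q * L + i) / ℓ * ℓ + i') (q * L + i + 1 - ((q * L + i) / ℓ * ℓ + i')))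
            (TV.ωhiV j)) = true) ∧
        (TV.gctx j L q).pairTest (q * L + i + 1) (q * L + i + 1) ((TV.gctx j L q).facOf (idIM TV.base.n) (TV.ωhiV j)) = true ∧
        (∀ i', i' < (q * L + i) / ℓ * ℓ - q * L → (TV.gctx j L q).pairTest (q * L + i') (q * L + i + 1)
          ((TV.gctx j L q).facOf (TV.prodM kitOf wT j ((q * L + i) / ℓ * ℓ) (q * L + i + 1 - (q * L + i) / ℓ * ℓ))
            (TV.vIn kitOf wT j ℓ (q * L + i') (((q * L + i) / ℓ * ℓ - ((q * L + i') / ℓ + 1) * ℓ) / ℓ))) = true) ∧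
        (∀ a' < q * L, (TV.gctx j L q).pairTest a' (q * L + i + 1)
          ((TV.gctx j L q).facOf (TV.prodM kitOf wT j ((q * L + i) / ℓ * ℓ) (q * L + i + 1 - (q * L + i) / ℓ * ℓ))
            (TV.vOut kitOf wT j L ℓ a' q (((q * L + i) / ℓ * ℓ - q * L) / ℓ))) = true)) ∧
      ∃ stF : GState2, TV.Inv2 kitOf wT j L ℓ q (q * L + min L (TV.S j - q * L)) stF ∧
        (TV.gctx j L q).claims2 (q * L + min L (TV.S j - q * L)) stF = true := by
  unfold growthRange2 at h
  rw [StageCtx.startNode_eq_nodeAt] at h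
  refine growthRun2_sound hℓ hdvd P _ _ _ h le_rfl ?_
  have hg : q * L / ℓ * ℓ = q * L := chunk_grid hdvd
  refine ⟨by simp [hg], fun i hi => by simp at hi, by simp [hg], fun i hi => by simp at hi, ?_, fun a' ha' => ?_, fun hlt => ?_⟩
  · show (TV.gctx j L q).W.size = q * L
    simp [gctx]
  · show (TV.gctx j L q).W.getD a' #[] = _
    show (Array.ofFn (n := q * L) fun a' : Fin (q * L) => TV.wVec j L a' (q - (a' / L + 1))).getD a' #[] = _
    rw [getD_ofFn_lt _ ha', hg, Nat.sub_self, Nat.zero_div]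
    rfl
  · rw [hg] at hlt; exact absurd hlt (lt_irrefl _)

end Inv


end CertTablesV

end Summit.NavierStokesRegularity.NavierStokesRegularity.Theorems.TaylorModelCert
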